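import Mathlib
import Summits.RiemannHypothesis.Statement
import Literature.NumberTheory.LFunctions.UniformWeilPositivityRH
import Literature.NumberTheory.LFunctions.WeilArchimedeanPositivityProofs
import Literature.NumberTheory.LFunctions.WeilGroundEnergyProofs
import Summits.RiemannHypothesis.RiemannHypothesis.Theorems.HandoffDecomposition
import Summits.RiemannHypothesis.RiemannHypothesis.Theorems.HandoffFailingStep
import Summits.RiemannHypothesis.RiemannHypothesis.Theorems.HandoffEventually
import Summits.RiemannHypothesis.RiemannHypothesis.Theorems.HandoffSectorCriterion
import Summits.RiemannHypothesis.RiemannHypothesis.Theorems.HandoffBottomDischarge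
import Summits.RiemannHypothesis.RiemannHypothesis.Theorems.HandoffMarginLaw
import Summits.RiemannHypothesis.RiemannHypothesis.Theorems.SoloInformedOnset
import Summits.RiemannHypothesis.RiemannHypothesis.Theorems.SoloInformedNonDegenerate
import Summits.RiemannHypothesis.RiemannHypothesis.Theorems.WeilWindowFlowGronwallLeakageStrictAnti
import Summits.RiemannHypothesis.RiemannHypothesis.Theorems.WeilGroundStateGroundStatesConvergeToXiEnergyLimit
import Summits.RiemannHypothesis.RiemannHypothesis.Theorems.GroundBartaEvenWinsBeyondArchPositivity8046
import Summits.RiemannHypothesis.RiemannHypothesis.Theorems.SemilocalNegCertUptoHundredThreeKinkedFinal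
import Literature.NumberTheory.LFunctions.GeneralizedRH
import Summits.RiemannHypothesis.RiemannHypothesis.Theorems.SuzukiWindowsDoorConverseRH
import Summits.RiemannHypothesis.RiemannHypothesis.Theorems.SuzukiWindowsDoorConverseLaplace
import Summits.RiemannHypothesis.RiemannHypothesis.Theorems.SuzukiWindowsDoorAllWindowsDetectRH
import Summits.RiemannHypothesis.RiemannHypothesis.Theorems.SuzukiCleanRadius
import Summits.RiemannHypothesis.RiemannHypothesis.Theorems.SuzukiSharpRadiusEightValue
import Summits.RiemannHypothesis.RiemannHypothesis.Theorems.SuzukiWeightedDoorLeaf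
import Summits.RiemannHypothesis.RiemannHypothesis.Theorems.MotivicDoorRungs
import Summits.RiemannHypothesis.RiemannHypothesis.Theorems.WeilFormatCDataA1RungCB
import Summits.RiemannHypothesis.RiemannHypothesis.Theorems.Splittings.BombieriFozNoDep
import Summits.RiemannHypothesis.RiemannHypothesis.Theorems.HandoffLadderRungOne
import HarnessLib

/-!
# Costume detectors V (WINDOW families: Weil cones `WeilPositivityOn a` / ground energy, and Suzuki's de Branges windows) — cell `rh-split`

HONEST LABEL: «SPLITTING SEARCH over kernel-typed RH-EQUIVALENCES; a splitting A ∧ B ⟹ RH is CONDITIONAL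
bookkeeping unless A and B are both proved; nothing here bears on the truth of RH.»

Companion of `CostumeDetectors.lean` (§4 WEIL window/prime-window axes), `CostumeDetectorsHeight.lean` (§2 DBR index-free
pair).  NEGATIVE KNOWLEDGE (brief `RH-SPLITTING-BRIEF.md` sha16 f79c5f09d8bcb036; cards SPLIT-weil-neg, SPLIT-dbr-finite,
SPLIT-dbr-bridge, SPLIT-dbr-neg): §1 WEIL — the window tail of Weil positivity is RH for every cut, the RH-free finite part
(`a ≤ 4/5` for the sign-free ground-energy form) is a theorem, the residual tail is RH, and a UNIFORM coercivity tail is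
REFUTED; §2 DBR — Suzuki's clean-window pairs: given the finite part (clean up to `T`) the beyond-tail is RH, with the
uniform `θ/25` form an RH-equivalence and an `∃`-tail form.  Raw quantified forms only (no `def`).  Typed by
rh-split-typer-2 with the weil-neg / dbr seats, merged and filed by rh-split-typer-1, refereed by rh-split-ref.  Inside
this namespace the bare token `RiemannHypothesis` is `Summit.RiemannHypothesis`; Mathlib's is `_root_.RiemannHypothesis`.
-/

noncomputable section

-- D-0017: `Summit.<S>.<S>.…` is the designed namespace of a single-problem summit.
set_option linter.dupNamespace false

namespace Summit.RiemannHypothesis.RiemannHypothesis.Theorems.Splittings.CostumeDetectorsWindows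

/-! ## §1 WEIL — window tails of Weil positivity / ground energy (card SPLIT-weil-neg) -/

section WeilNeg
open Filter Topology Literature.NumberTheory.LFunctions
open Summit.RiemannHypothesis.RiemannHypothesis.Theorems
open Summit.RiemannHypothesis.RiemannHypothesis.Theorems.HandoffDecomposition
open Summit.RiemannHypothesis.RiemannHypothesis.Theorems.HandoffMarginLaw

/-! ### S1 window cut -/

/-- S1: the window tail is RH for every `H ≥ 0` (F1-free); FIN is decoration by `WeilPositivityOn.mono`. [folklore] -/
theorem tailW_iff_rh {H : ℝ} (hH : 0 ≤ H) : (∀ a : ℝ, H < a → WeilPositivityOn a) ↔ _root_.RiemannHypothesis := by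
  rw [riemannHypothesis_iff_forall_weilPositivityOn]
  refine ⟨fun h a ha ↦ ?_, fun h a ha ↦ h a (hH.trans_lt ha)⟩
  exact (h (max a H + 1) (by linarith [le_max_right a H])).mono (by linarith [le_max_left a H])

/-- S1: TAIL ⟹ FIN in one line. [folklore] -/
theorem finW_of_tailW {H : ℝ} (h : ∀ a : ℝ, H < a → WeilPositivityOn a) : WeilPositivityOn H :=
  (h (H + 1) (by linarith)).mono (by linarith)

/-! ### S2 prime-window cut, S3 increment cut -/

/-- S2: tree theorem, every cut `Q`. [folklore] -/
example (Q : ℕ) : Summit.RiemannHypothesis ↔ ∀ q : ℕ, q.Prime → Q ≤ q → HandoffH q :=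
  riemannHypothesis_iff_forall_ge_handoffH Q

/-- S3: the step tail IS the bridge residual (tree theorem). [folklore] -/
example {q₀ : ℕ} (hq₀ : q₀.Prime) :
    (∀ q : ℕ, q.Prime → q₀ ≤ q → HandoffStep q) ↔ (WeilPositivityOn (Real.log q₀ / 2) → Summit.RiemannHypothesis) :=
  forall_ge_handoffStep_iff hq₀

/-! ### S4 the sign-free (Yoshida Thm 2) split — re-typed from the onset theory -/

/-- S4 FIN certified by ONE rung above `H` (strict antitonicity of the ground energy). [folklore] -/
theorem finND_of_weilPositivityOn {H A : ℝ} (hHA : H < A) (hA : WeilPositivityOn A) :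
    ∀ a : ℝ, 0 < a → a ≤ H → weilGroundEnergy a ≠ 0 :=
  fun _ ha haH ↦ (WeilWindowFlowGronwallLeakage.weilGroundEnergy_pos_of_weilPositivityOn_of_lt hA ha
    (haH.trans_lt hHA)).ne'

/-- S4 `finND_four_fifths` is a THEOREM (rung 0.8046). [folklore] -/
theorem finND_four_fifths : ∀ a : ℝ, 0 < a → a ≤ 4 / 5 → weilGroundEnergy a ≠ 0 :=
  finND_of_weilPositivityOn (by norm_num : (4 : ℝ) / 5 < 4023 / 5000)
    (EvenWinsBeyondArch.weilPositivityOn_of_le_8046 le_rfl)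

/-- S4 bookkeeping `FinND H ∧ TailND H ⟹ RH`. [folklore] -/
theorem rh_of_finND_tailND {H : ℝ} (hF : ∀ a : ℝ, 0 < a → a ≤ H → weilGroundEnergy a ≠ 0)
    (hT : ∀ a : ℝ, H < a → weilGroundEnergy a ≠ 0) : _root_.RiemannHypothesis :=
  riemannHypothesis_iff_forall_weilGroundEnergy_ne_zero.2 fun a ha ↦ by
    rcases le_or_gt a H with h | h
    · exact hF a ha h
    · exact hT a h

/-- S4 KEY (card's `tailND_iff_residual`): «no degenerate window beyond H» IS the bridge residual
«(a rung beyond H) → RH». [folklore] -/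
theorem tailND_iff_residual {H : ℝ} (hH : 0 ≤ H) :
    (∀ a : ℝ, H < a → weilGroundEnergy a ≠ 0) ↔
      ((∃ a : ℝ, H < a ∧ WeilPositivityOn a) → _root_.RiemannHypothesis) := by
  constructor
  · rintro hT ⟨a, ha, hWa⟩
    by_contra hRH
    obtain ⟨a₀, ha₀⟩ := exists_isWeilOnset_of_not_riemannHypothesis hRH
    have hle : a ≤ a₀ := ha₀.le_of_weilPositivityOn hWa
    exact hT a₀ (ha.trans_le hle) ha₀.eq_zero
  · intro hres a ha
    by_cases hRH : _root_.RiemannHypothesis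
    · exact (weilGroundEnergy_pos_of_riemannHypothesis hRH (hH.trans_lt ha)).ne'
    · have hnW : ¬ WeilPositivityOn a := fun hW ↦ hRH (hres ⟨a, ha, hW⟩)
      have hneg : ¬ 0 ≤ weilGroundEnergy a := fun h0 ↦
        hnW ((weilGroundEnergy_nonneg_iff_holds (hH.trans_lt ha)).1 h0)
      exact (lt_of_not_ge hneg).ne

/-- S4 at the certified cut: `TailND (4/5) ↔ RH`. [folklore] -/
theorem tailND_four_fifths_iff_rh : (∀ a : ℝ, 4 / 5 < a → weilGroundEnergy a ≠ 0) ↔ _root_.RiemannHypothesis :=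
  ⟨rh_of_finND_tailND finND_four_fifths,
    fun h a ha ↦ (weilGroundEnergy_pos_of_riemannHypothesis h (by linarith)).ne'⟩

/-! ### S5 parity sectors, S6 weakened sign tails — tree theorems by name -/

example : Summit.RiemannHypothesis ↔ ∀ q : ℕ, q.Prime → 0 ≤ weilEvenGroundEnergy (Real.log (nextPrime q) / 2) :=
  HandoffSectorCriterion.riemannHypothesis_iff_forall_even
example : Summit.RiemannHypothesis ↔ ∀ q : ℕ, q.Prime → 0 ≤ weilOddGroundEnergy (Real.log (nextPrime q) / 2) :=
  HandoffSectorCriterion.riemannHypothesis_iff_forall_odd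
example : Summit.RiemannHypothesis ↔ ∃ C T : ℝ, ∀ t : ℝ, T ≤ t → -C ≤ weilGroundEnergy t :=
  riemannHypothesis_iff_eventually_ge_weilGroundEnergy
example : Summit.RiemannHypothesis ↔
    ∀ α : ℝ, 0 < α → ∃ C T : ℝ, ∀ t : ℝ, T ≤ t → -C * Real.exp (2 * α * t) ≤ weilGroundEnergy t :=
  riemannHypothesis_iff_forall_eventually_ge_neg_exp

/-! ### S7 REFUTATIONS (not detectors): quantitative window tails that are FALSE, RH-free -/

/-- S7a: uniform coercivity beyond `H` is FALSE for every `H` (ε → 0 or ε → −∞). [folklore] -/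
theorem not_uniformCoercive (H : ℝ) : ¬ ∃ c : ℝ, 0 < c ∧ ∀ a : ℝ, H < a → c ≤ weilGroundEnergy a := by
  rintro ⟨c, hc, h⟩
  have hev : ∀ᶠ a in atTop, weilGroundEnergy a < c := by
    rcases GroundStatesConvergeToXi.tendsto_weilGroundEnergy_zero_or_atBot with h0 | hbot
    · exact (h0.eventually (gt_mem_nhds hc))
    · exact (hbot.eventually (eventually_lt_atBot c))
  obtain ⟨a, ha, hlt⟩ := (hev.and (eventually_gt_atTop H)).exists
  exact (lt_irrefl _) ((h a hlt).trans_lt ha)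

-- S7b (a constant positive threshold margin is FALSE) is the tree theorem `Handoff.not_handoffMargin_const_of_pos`
-- (module `Theorems.HandoffWallCeiling`, not imported here).

/-- S7c: the twin wall `q = 107`: `δ*(107) < 1/107` (certified `a*({p ≤ 103}) < (log 109)/2`). [folklore] -/
theorem wallOffset_107_lt : wallOffset 107 < 1 / 107 := by
  have hset : Nat.primesBelow 107 =
      {2, 3, 5, 7, 11, 13, 17, 19, 23, 29, 31, 37, 41, 43, 47, 53, 59, 61, 67, 71, 73, 79, 83, 89, 97, 101, 103} := by
    decide
  have hcert := SemilocalPolyWitness.weilSemilocalThreshold_uptoHundredThree_lt_log_hundrednine_half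
  have hlog : Real.log 109 - Real.log 107 < 2 / 107 := by
    rw [← Real.log_div (by norm_num) (by norm_num)]
    have := Real.log_lt_sub_one_of_pos (show (0 : ℝ) < 109 / 107 by norm_num) (by norm_num)
    linarith
  unfold wallOffset
  rw [hset]
  push_cast
  linarith

/-- S7c: hence `MARGIN(1/q)` is FALSE. [folklore] -/
theorem not_invMargin : ¬ HandoffMargin (fun q ↦ 1 / (q : ℝ)) := by
  intro h
  have h107 := h 107 (by norm_num)
  have := wallOffset_107_lt
  unfold wallOffset at this
  linarith

end WeilNeg

/-! ### S8 (card SPLIT-weil-finite, seat rh-split-weil-finite §2): the WEAKEST admissible tail `RH ∨ a₀ < H` is literally `FIN(H) → RH`, and at the kernel reach `H = 1` it IS RH -/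

section WeilFinite
open Literature.NumberTheory.LFunctions
open Summit.RiemannHypothesis.RiemannHypothesis.Theorems.MotivicDoor.Rungs
open Summit.RiemannHypothesis.RiemannHypothesis.Theorems.WeilFormatCData.A1 (weilPositivityOn_one)

/-- WEIL forced label at the PROVED reach (brief rh-split weil, card SPLIT-weil-finite): since `WeilPositivityOn 1` is a
kernel theorem (`WeilFormatCData.A1.weilPositivityOn_one`, std axioms), the weakest tail `RH ∨ (Yoshida's threshold
a₀ < 1)` is RH itself (Yoshida Prop. 6 dichotomy `weilPositivityOn_iff_rh_or_le_threshold`). F1-free.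
[cite: Yoshida1992HermitianForms, Prop. 6 (p. 320)] -/
theorem weil_tailmin_one_iff_rh :
    (_root_.RiemannHypothesis ∨ weilPositivityThreshold < 1) ↔ _root_.RiemannHypothesis := by
  refine ⟨fun h ↦ ?_, Or.inl⟩
  rcases h with hRH | hlt
  · exact hRH
  · rcases (weilPositivityOn_iff_rh_or_le_threshold one_pos).1 weilPositivityOn_one with hRH | hle
    · exact hRH
    · exact absurd hle (not_le.2 hlt)

/-- WEIL, the weakest complement of the finite part (card SPLIT-weil-finite `tailmin_iff_fin_imp_rh`): for `H > 0`,
`(RH ∨ a₀ < H) ↔ (WeilPositivityOn H → RH)` — the minimal `B` completing `FIN(H) = WeilPositivityOn H` to RH is the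
conditional itself (Yoshida Prop. 6 + the tree's dichotomy `riemannHypothesis_or_threshold_ge_59_100`); CONDITIONAL
bookkeeping, not a second theorem. [cite: Yoshida1992HermitianForms, Prop. 6 (p. 320)] -/
theorem weil_tailmin_iff_fin_imp_rh {H : ℝ} (hH : 0 < H) :
    (_root_.RiemannHypothesis ∨ weilPositivityThreshold < H) ↔ (WeilPositivityOn H → _root_.RiemannHypothesis) := by
  refine ⟨fun ht hf ↦ ?_, fun himp ↦ ?_⟩
  · rcases ht with hRH | hlt
    · exact hRH
    · rcases (weilPositivityOn_iff_rh_or_le_threshold hH).1 hf with hRH | hle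
      · exact hRH
      · exact absurd hle (not_le.2 hlt)
  · by_cases hRH : _root_.RiemannHypothesis
    · exact Or.inl hRH
    · right
      by_contra hle
      rw [not_lt] at hle
      rcases riemannHypothesis_or_threshold_ge_59_100 with h | ⟨-, hpos, -⟩
      · exact hRH h
      · exact hRH (himp (hpos H hle))

end WeilFinite

/-! ## §2 DBR — Suzuki clean-window tails (cards SPLIT-dbr-finite / -bridge / -neg) -/

section Dbr
open Literature.NumberTheory.LFunctions
open Summit.RiemannHypothesis.RiemannHypothesis.Theorems
open Summit.RiemannHypothesis.RiemannHypothesis.Theorems.SuzukiWeightedDoor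

/-! ### dbr-finite Splitting A «SuzukiWindowSplit» (window cut = prime cutoff) -/

/-- FIN(θ,T) ∧ TAIL(θ,T) ⟹ RH for the single operator `K_θ`, `θ > 10` (raw form; `CleanUpTo` is the tree def).
[folklore] -/
theorem rh_of_cleanUpTo_of_cleanBeyond {θ T : ℝ} (hθ : 10 < θ) (hFin : SuzukiCleanRadius.CleanUpTo θ T)
    (hTail : ∀ t : ℝ, T < t → NoUnitEigenvalue (limKernel θ) t) : _root_.RiemannHypothesis := by
  refine (SuzukiWindowsDoorConverse.allWindows_iff_riemannHypothesis
    suzukiWindowsDoor_allWindowsDetectRH_proof hθ).1 fun t ht ↦ ?_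
  rw [SuzukiWindowsDoorConverse.limKernel_eq_lit]
  rcases le_or_gt t T with h | h
  · exact hFin t ht h
  · exact hTail t h

/-- RH ⟹ TAIL (every window clean under RH). [folklore] -/
theorem cleanBeyond_of_rh {θ T : ℝ} (hθ : 10 < θ) (h : _root_.RiemannHypothesis) :
    ∀ t : ℝ, T < t → NoUnitEigenvalue (limKernel θ) t := fun t _ ↦ by
  rw [← SuzukiWindowsDoorConverse.limKernel_eq_lit]
  exact SuzukiWindowsDoorConverse.noUnitEigenvalue_limKernel_of_riemannHypothesis h hθ t

/-- TAIL LEMMA instance: given the certificate FIN(θ,T), TAIL(θ,T) ⟺ RH. [folklore] -/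
theorem cleanBeyond_iff_rh_of_cleanUpTo {θ T : ℝ} (hθ : 10 < θ) (hFin : SuzukiCleanRadius.CleanUpTo θ T) :
    (∀ t : ℝ, T < t → NoUnitEigenvalue (limKernel θ) t) ↔ _root_.RiemannHypothesis :=
  ⟨rh_of_cleanUpTo_of_cleanBeyond hθ hFin, cleanBeyond_of_rh hθ⟩

/-- dbr-finite's CERTIFICATE-FREE closed form (card: `uniformCleanBeyond_div_25_iff_riemannHypothesis`): the finite
parts are absorbed by the RH-free theorem `SuzukiSharpRadius.clean_up_to_div_25`. [folklore] -/
theorem uniformCleanBeyond_div_25_iff_rh :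
    (∀ θ : ℝ, 11 ≤ θ → ∀ t : ℝ, θ / 25 < t → NoUnitEigenvalue (limKernel θ) t) ↔ _root_.RiemannHypothesis := by
  constructor
  · intro h
    obtain ⟨θ₁, hθ₁⟩ := SuzukiSharpRadius.clean_up_to_div_25
    set θ := max θ₁ 11 with hθdef
    have hθ10 : (10 : ℝ) < θ := lt_of_lt_of_le (by norm_num) (le_max_right θ₁ 11)
    exact rh_of_cleanUpTo_of_cleanBeyond hθ10 (hθ₁ θ (le_max_left _ _)) (h θ (le_max_right _ _))
  · intro hRH θ hθ t _
    rw [← SuzukiWindowsDoorConverse.limKernel_eq_lit]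
    exact SuzukiWindowsDoorConverse.noUnitEigenvalue_limKernel_of_riemannHypothesis hRH (by linarith) t

/-! ### dbr-bridge: height-axis tail trap with NO hypothesis; weight-axis bridge from quasi-RH -/

/-- dbr-bridge `exists_tail_iff_rh`: for large `θ` the tail beyond `c·θ` IS RH, unconditionally
(`SuzukiCleanRadius.exists_linear_clean_radius`). [folklore] -/
theorem exists_tail_iff_rh : ∃ c : ℝ, 0 < c ∧ ∃ θ₁ : ℝ, ∀ θ : ℝ, θ₁ ≤ θ → 10 < θ →
    ((∀ t : ℝ, c * θ < t → NoUnitEigenvalue (limKernel θ) t) ↔ _root_.RiemannHypothesis) := by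
  obtain ⟨c, hc, θ₁, h⟩ := SuzukiCleanRadius.exists_linear_clean_radius
  exact ⟨c, hc, θ₁, fun θ hθ hθ10 ↦ cleanBeyond_iff_rh_of_cleanUpTo hθ10 fun t ht0 htc ↦ h θ hθ t ht0 htc⟩

/-- dbr-bridge Bridge 1 (`weightedTail_of_A`): quasi-RH(σ₀) gives the η-weighted witness for every `η > σ₀ − 1/2`
— the weight axis IS the zero-free abscissa (`growthAbscissaIdentity_holds`). [folklore] -/
theorem weightedWitness_of_quasiRH {σ₀ θ η : ℝ} (hθ : 10 < θ) (h1 : 1 / 2 ≤ σ₀) (h2 : σ₀ < 1 / 2 + η)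
    (hA : QuasiRiemannHypothesis σ₀) : WeightedWitness θ η := by
  refine (growthAbscissaIdentity_holds θ hθ η (by linarith)).2 σ₀ h1 h2 fun s hs hxi ↦ ?_
  obtain ⟨hζ, -, hlt1⟩ := (riemannXi_eq_zero_iff_holds s).1 hxi
  exact hA s hζ hs hlt1

end Dbr

/-! ## §3 WEIL-BRIDGE — the window-indexed Bombieri splitting `BombieriWindow(H)` in raw form (card SPLIT-weil-bridge; typed by rh-split-weil-bridge; mod the named fact `Bombieri2000.corollary11`) -/

section WeilBridge
open Literature.NumberTheory.LFunctions Literature.NumberTheory.LFunctions.Bombieri2000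
open HandoffDecomposition Splittings.BombieriFozNoDep Summit.RiemannHypothesis.RiemannHypothesis.Theses.RuelleBand

/-! ## (weil, bridge) §W-B.0 — window arithmetic and the FIN rungs -/

/-- `0 < (log H)/2` for `H ≥ 2`. [folklore] -/
theorem weil_log_half_pos {H : ℕ} (hH : 2 ≤ H) : 0 < Real.log H / 2 := by
  have : (1 : ℝ) < H := by exact_mod_cast hH
  have := Real.log_pos this
  linarith

/-- `(log H)/2 ≤ 1` for `2 ≤ H ≤ 7` (tree `HandoffLadderRungOne.log_seven_half_le_one`). [folklore] -/
theorem weil_log_half_le_one {H : ℕ} (hH : 2 ≤ H) (h7 : H ≤ 7) : Real.log H / 2 ≤ 1 := by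
  have h0 : (0 : ℝ) < H := by exact_mod_cast (lt_of_lt_of_le (by norm_num) hH)
  have hle : (H : ℝ) ≤ 7 := by exact_mod_cast h7
  have := Real.log_le_log h0 hle
  linarith [HandoffLadderRungOne.log_seven_half_le_one]

/-- FIN(H) = `WeilPositivityOn ((log H)/2)` is a tree THEOREM for `2 ≤ H ≤ 7` (certified window `a = 1`,
`WeilFormatCData.A1.weilPositivityOn_one`, plus antitonicity). [tree theorem] -/
theorem weilPositivityOn_log_half_of_le_seven {H : ℕ} (hH : 2 ≤ H) (h7 : H ≤ 7) :
    WeilPositivityOn (Real.log H / 2) :=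
  WeilFormatCData.A1.weilPositivityOn_one.mono (weil_log_half_le_one hH h7)

/-- FIN strengthens as `H` grows: `FIN(H') → FIN(H)` for `1 ≤ H ≤ H'`. [tree theorem] -/
theorem weilPositivityOn_log_half_anti {H H' : ℕ} (hH : 1 ≤ H) (hle : H ≤ H')
    (h : WeilPositivityOn (Real.log H' / 2)) : WeilPositivityOn (Real.log H / 2) := by
  refine WeilPositivityOn.mono ?_ h
  have h0 : (0 : ℝ) < H := by exact_mod_cast hH
  have hle' : (H : ℝ) ≤ H' := by exact_mod_cast hle
  have := Real.log_le_log h0 hle'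
  linarith

/-- FIN is RH-implied at every window `H ≥ 2` (Weil's criterion, easy direction). [tree theorem] -/
theorem weilPositivityOn_log_half_of_rh (h : _root_.RiemannHypothesis) {H : ℕ} (hH : 2 ≤ H) :
    WeilPositivityOn (Real.log H / 2) :=
  riemannHypothesis_iff_forall_weilPositivityOn.1 h _ (weil_log_half_pos hH)

/-- COSTUME DETECTOR for bridges: `C → (FIN → RH)` is the same statement as `C ∧ FIN → RH`; a bridge
conjecture `C` makes FIN load-bearing iff `C → RH` is not derivable. [folklore] -/
theorem weil_bridge_iff (C : Prop) (a : ℝ) :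
    (C → (WeilPositivityOn a → _root_.RiemannHypothesis)) ↔ (C ∧ WeilPositivityOn a → _root_.RiemannHypothesis) :=
  ⟨fun h hCF ↦ h hCF.1 hCF.2, fun h hC hF ↦ h ⟨hC, hF⟩⟩

/-! ## (weil, bridge) §W-B.1 — the splitting `RH ↔ FIN(H) ∧ (FOZ ∧ NoDep((log H)/2))` (mod `corollary11`) -/

/-- **SPLITTING `BombieriWindow(H)`**: `WPO((log H)/2) ∧ FOZ ∧ NoDep((log H)/2) ⟹ RH`, conditional on the
named fact `corollary11` (the X-1 theorem `rh_of_foz_noDep` read at `a = (log H)/2`).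
[cite: Bombieri2000Weil, Thm. 11 and Corollary] -/
theorem rh_of_weilPositivityOn_foz_noDep (h11 : corollary11) {H : ℕ} (hH : 2 ≤ H)
    (hA : WeilPositivityOn (Real.log H / 2)) (hF : CofiniteCriticalLine) (hN : NoDep (Real.log H / 2)) :
    _root_.RiemannHypothesis :=
  Summit.RiemannHypothesis_iff.1 (Summit.RiemannHypothesis_iff.2 (rh_of_foz_noDep h11 (weil_log_half_pos hH) hA hF hN))

/-- The tail `B(H) = FOZ ∧ NoDep((log H)/2)` is RH-implied (empty exceptional set; vacuous mass condition). [tree theorems] -/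
theorem foz_noDep_of_rh (h : _root_.RiemannHypothesis) (a : ℝ) : CofiniteCriticalLine ∧ NoDep a :=
  ⟨cofiniteCriticalLine_of_rh h, noDep_of_rh h a⟩

/-- **The splitting family**: for every `H ≥ 2`, `RH ↔ WPO((log H)/2) ∧ (FOZ ∧ NoDep((log H)/2))` (mod the fact).
FIN(H) strengthens with `H`, the tail weakens with `H`. [cite: Bombieri2000Weil, Thm. 11 and Corollary] -/
theorem rh_iff_weilPositivityOn_and_foz_noDep (h11 : corollary11) {H : ℕ} (hH : 2 ≤ H) :
    _root_.RiemannHypothesis ↔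
      WeilPositivityOn (Real.log H / 2) ∧ (CofiniteCriticalLine ∧ NoDep (Real.log H / 2)) :=
  ⟨fun h ↦ ⟨weilPositivityOn_log_half_of_rh h hH, foz_noDep_of_rh h _⟩,
    fun h ↦ rh_of_weilPositivityOn_foz_noDep h11 hH h.1 h.2.1 h.2.2⟩

/-- DECORATIVE REGIME: inside the certified window (`0 < a ≤ 1`) the tail alone is RH (mod the fact):
`RH ↔ FOZ ∧ NoDep a`. X-1's `rh_iff_foz_and_noDep_yoshida` is the case `a = (log 2)/2`. -/
theorem rh_iff_foz_noDep_of_le_one (h11 : corollary11) {a : ℝ} (ha : 0 < a) (ha1 : a ≤ 1) :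
    _root_.RiemannHypothesis ↔ CofiniteCriticalLine ∧ NoDep a :=
  ⟨fun h ↦ foz_noDep_of_rh h a,
    fun h ↦ Summit.RiemannHypothesis_iff.1 (Summit.RiemannHypothesis_iff.2
      (rh_of_foz_noDep h11 ha (WeilFormatCData.A1.weilPositivityOn_one.mono ha1) h.1 h.2))⟩

/-- In particular for `2 ≤ H ≤ 7`: `RH ↔ FOZ ∧ NoDep((log H)/2)` (mod the fact) — at these `H` the split
`FIN(H) ∧ B(H)` is a RELABELLING; FIN(H) is load-bearing only beyond the certified window. -/
theorem rh_iff_foz_noDep_log_half_of_le_seven (h11 : corollary11) {H : ℕ} (hH : 2 ≤ H) (h7 : H ≤ 7) :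
    _root_.RiemannHypothesis ↔ CofiniteCriticalLine ∧ NoDep (Real.log H / 2) :=
  rh_iff_foz_noDep_of_le_one h11 (weil_log_half_pos hH) (weil_log_half_le_one hH h7)

/-- THE BRIDGE in the cell's increment-tail vocabulary: `FOZ ∧ NoDep((log H)/2)` implies the increment tail
`∀ primes q ≥ H, HandoffStep q` (mod the fact), via the tree theorem `forall_ge_handoffStep_iff`
(the increment tail is worth exactly `WPO((log H)/2) → RH`). -/
theorem stepTail_of_foz_noDep (h11 : corollary11) {H : ℕ} (hH : H.Prime)
    (hF : CofiniteCriticalLine) (hN : NoDep (Real.log H / 2)) :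
    ∀ q : ℕ, q.Prime → H ≤ q → HandoffStep q :=
  (forall_ge_handoffStep_iff hH).2 fun hA ↦
    Summit.RiemannHypothesis_iff.2 (rh_of_weilPositivityOn_foz_noDep h11 hH.two_le hA hF hN)

end WeilBridge

end Summit.RiemannHypothesis.RiemannHypothesis.Theorems.Splittings.CostumeDetectorsWindows

end
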